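import Mathlib
import HarnessLib

/-!
# Route `UniversalDetector`, crux `DetectorRigidity` (stmt-QuantumFields-26595): the DISCRETE DETECTOR rung (BC5)

Helper file (`--supports stmt-QuantumFields-26595`) of the ideator seat `ym-idea-8` (generation 2, LINE 4).  The crux
`DetectorRigidity` says: a reflection-positive kernel whose mirror pairing against ONE fixed positive detector vanishes is
identically zero — because reflection positivity turns the time shift into a self-adjoint CONTRACTION SEMIGROUP, which
is injective, and a positive combination of its powers cannot annihilate a non-zero vector.  This file proves the
finite-dimensional, discrete-time model of exactly that mechanism, as typed (plan-only) in the route's birth certificate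
(`bc/UniversalDetector_rung_plan.lean`, `Stmt_rung_discreteDetector`):

* `DiscreteDetector` — for a real symmetric positive-semidefinite matrix `P` with `P.mulVec` injective (the one-step
  transfer operator `e^{-H}`), non-negative weights `c : Fin m → ℝ` not all zero (the detector `h(t) ≥ 0`, `h ≢ 0`) and
  a vector `w`:  `∑ₛ ∑ₜ c s · c t · ⟨w, P^(s+t) w⟩ = 0 → w = 0`.

Proof: the double sum is `‖u‖²` for `u = ∑ₜ c t • P^t w` (symmetry of `P`), so `u = 0`; then
`0 = ⟨w, u⟩ = ∑ₜ c t ⟨w, P^t w⟩` is a sum of non-negative terms (`P^t` is PSD), so each vanishes; at an index `t₀` with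
`c t₀ ≠ 0` this gives `⟨w, P^{t₀} w⟩ = 0`, hence `P^{t₀} w = 0` (PSD), hence `w = 0` (injectivity of `P`, iterated).
The hypothesis `(1 - P).PosSemidef` (contraction) of the typed rung is carried but not needed for this direction.

No summit, leg or spine crux is proved here; `NT`, `UV`, `IR` stay open.
-/

set_option autoImplicit false

namespace Summit.QuantumFields.YangMills.Cruxes.DetectorRigidity.Rung

open Matrix Finset

variable {n : ℕ}

/-- Powers of an injective matrix act injectively. -/
theorem mulVec_pow_injective (P : Matrix (Fin n) (Fin n) ℝ) (hP : Function.Injective P.mulVec) (t : ℕ) :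
    Function.Injective (P ^ t).mulVec := by
  induction t with
  | zero =>
      intro x y hxy
      simpa using hxy
  | succ t ih =>
      intro x y hxy
      have h1 : (P ^ t).mulVec (P.mulVec x) = (P ^ t).mulVec (P.mulVec y) := by
        simpa [pow_succ, Matrix.mulVec_mulVec] using hxy
      exact hP (ih h1)

/-- For symmetric `P`: `⟨w, P^(s+t) w⟩ = ⟨P^s w, P^t w⟩`. -/
theorem dotProduct_pow_add (P : Matrix (Fin n) (Fin n) ℝ) (hP : P.IsSymm) (w : Fin n → ℝ) (s t : ℕ) :
    w ⬝ᵥ (P ^ (s + t)).mulVec w = ((P ^ s).mulVec w) ⬝ᵥ ((P ^ t).mulVec w) := by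
  have hs : (P ^ s).IsSymm := hP.pow s
  calc w ⬝ᵥ (P ^ (s + t)).mulVec w
      = w ⬝ᵥ (P ^ s).mulVec ((P ^ t).mulVec w) := by rw [pow_add, Matrix.mulVec_mulVec]
    _ = (Matrix.vecMul w (P ^ s)) ⬝ᵥ ((P ^ t).mulVec w) := by rw [Matrix.dotProduct_mulVec]
    _ = ((P ^ s).mulVec w) ⬝ᵥ ((P ^ t).mulVec w) := by
        congr 1
        rw [← Matrix.mulVec_transpose, hs.eq]

/-- **The discrete detector lemma** (BC5 rung of `DetectorRigidity`, statement verbatim from the birth certificate). -/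
theorem DiscreteDetector :
    ∀ (n m : ℕ) (P : Matrix (Fin n) (Fin n) ℝ) (c : Fin m → ℝ) (w : Fin n → ℝ),
      P.IsSymm → P.PosSemidef → (1 - P).PosSemidef → Function.Injective P.mulVec →
      (∀ t, 0 ≤ c t) → (∃ t, c t ≠ 0) →
      (∑ s : Fin m, ∑ t : Fin m, c s * c t * (w ⬝ᵥ (P ^ (s.val + t.val)).mulVec w)) = 0 → w = 0 := by
  intro n m P c w hsymm hpsd _hcontr hinj hc hne hsum
  classical
  -- the detector vector
  set u : Fin n → ℝ := ∑ t : Fin m, c t • (P ^ t.val).mulVec w with hu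
  -- the double sum is ‖u‖²
  have hsq : u ⬝ᵥ u = ∑ s : Fin m, ∑ t : Fin m, c s * c t * (w ⬝ᵥ (P ^ (s.val + t.val)).mulVec w) := by
    rw [hu, sum_dotProduct]
    refine Finset.sum_congr rfl fun s _ => ?_
    rw [dotProduct_sum]
    refine Finset.sum_congr rfl fun t _ => ?_
    rw [smul_dotProduct, dotProduct_smul, smul_eq_mul, smul_eq_mul,
      dotProduct_pow_add P hsymm w s.val t.val]
    ring
  have hu0 : u = 0 := by
    have : u ⬝ᵥ u = 0 := by rw [hsq]; exact hsum
    exact dotProduct_self_eq_zero.mp this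
  -- pair with w: a sum of non-negative terms vanishes
  have hterms : ∀ t : Fin m, 0 ≤ c t * (w ⬝ᵥ (P ^ t.val).mulVec w) := by
    intro t
    have h := (hpsd.pow t.val).dotProduct_mulVec_nonneg w
    simp only [star_trivial] at h
    exact mul_nonneg (hc t) h
  have hpair : ∑ t : Fin m, c t * (w ⬝ᵥ (P ^ t.val).mulVec w) = 0 := by
    have : w ⬝ᵥ u = 0 := by rw [hu0]; exact dotProduct_zero w
    rw [hu, dotProduct_sum] at this
    simpa [dotProduct_smul, smul_eq_mul] using this
  have hzero : ∀ t : Fin m, c t * (w ⬝ᵥ (P ^ t.val).mulVec w) = 0 :=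
    fun t => (Finset.sum_eq_zero_iff_of_nonneg (fun t _ => hterms t)).mp hpair t (Finset.mem_univ t)
  obtain ⟨t₀, ht₀⟩ := hne
  have hq : w ⬝ᵥ (P ^ t₀.val).mulVec w = 0 := by
    rcases mul_eq_zero.mp (hzero t₀) with h | h
    · exact absurd h ht₀
    · exact h
  have hPw : (P ^ t₀.val).mulVec w = 0 := by
    have h := (hpsd.pow t₀.val).dotProduct_mulVec_zero_iff w
    simp only [star_trivial] at h
    exact h.mp hq
  have : (P ^ t₀.val).mulVec w = (P ^ t₀.val).mulVec 0 := by rw [hPw, Matrix.mulVec_zero]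
  exact mulVec_pow_injective P hinj t₀.val this

end Summit.QuantumFields.YangMills.Cruxes.DetectorRigidity.Rung
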